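import Summits.BirchSwinnertonDyer.Rank1Residual.X12.CMRamifiedReducible
import Summits.BirchSwinnertonDyer.Rank1Residual.Additive.RamifiedTwistConductor
import Literature.NumberTheory.EllipticCurves.ComplexMultiplicationNotSemistable
import Literature.NumberTheory.DiophantineGeometry.ConductorExponentZeroProofs
import HarnessLib

/-!
# CM curves over `ℚ` have ADDITIVE reduction at every odd prime ramified in the CM field —
# at odd `p ∣ d_K` a CM pair is Eisenstein-additive (X3-shaped); every X12 pair at `p ≥ 5` is
# additive at `p`; a CM curve is irreducible at every odd GOOD prime

HONEST FRAMING (cell `b2b-bsdres`, run/shared/lean/b2b/bsd-rank1-residual/, verbatim in every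
file): the goal of the cell is to DELETE the COMBINATION-SHAPED residual classes of the
Birch–Swinnerton-Dyer formula for ALL analytic-rank `≤ 1` elliptic curves over `ℚ` — "full BSD
formula for every rank `≤ 1` curve in class `C`" assembled STRICTLY from published theorems — so
that the rank-`≤ 1` remainder becomes exactly the CONSTRUCTION-SHAPED classes, which are TYPED
(missing-input `Prop`s), NOT attempted. This is not "finishing BSD". Harvest seat 1 (census owner
of class X12), generation 16. Theorems only (no definition, no named fact, no axiom); X12 REMAINS
CONSTRUCTION-SHAPED; nothing is booked; no label and no census number moves.

## What is proved

* `not_good_of_hasCM_of_dvd_cmFieldDiscrOfJ`: **`HasCM E`, `p` odd, `p ∣ d_K` ⟹ `E` has BAD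
  reduction at `p`**; with the tree's `not_mult_of_hasCM` (no multiplicative prime on a CM curve,
  Silverman *AT* II.6.4) it is **additive** (`addv_of_hasCM_of_cmRamified`), and with gen 16's
  `red_of_cmRamified` the pair satisfies the X3 PREDICATE `red(p) ∧ add(p)`
  (`classX3_of_hasCM_of_cmRamified`): the ramified X12 pairs (census 113 of 238) are
  Eisenstein-ADDITIVE pairs. Contrapositive: **a CM curve has irreducible `E[p]` at every odd
  prime of GOOD reduction** (`irr_of_hasCM_of_good`; gen 13 had `p ≥ 5` only) — the PARTITION
  grid cells "cm ∧ good(p) ∧ red(p), p odd" and "cm ∧ good(p) ∧ CMRamified(p), p odd" are EMPTY.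
* On class X12 (gen 15 `not_good_of_classX12_of_not_cmRamified` did the unramified half):
  **every X12 pair at `p ≥ 5` is additive at `p`** (`addv_of_classX12_of_five_le`) and is
  X3-shaped or X4-shaped according as `p ∣ d_K` or not (`classX3_or_classX4_of_classX12_of_five_le`).
* Summary at odd `p` for a CM curve (`cm_odd_prime_dichotomy`):
  `(p ∤ d_K ∧ irr(p)) ∨ (p ∣ d_K ∧ red(p) ∧ add(p))`.

## Proof (compositions of tree theorems BY NAME)

Suppose `W` is good at `p`. By gen 15's `exists_isGloballyMinimal_isIsogenous_maximal_cmFieldDiscr_eq`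
(Silverman *AT* II Ex. 2.12(b)) `W ~ W₁`, `W₁` globally minimal with `j(W₁)` of maximal order and
`cmFieldDiscr j(W₁) = d_K`; good reduction is a `ℚ`-isogeny invariant (*AEC* VII.7.2,
`IsIsogenous.hasGoodReductionAtPrime_iff`), so `W₁` and — through the tree-PROVED CM isogeny
`W₁ ~ W₁^{(d_K)}` (Burungale–Flach 2024 proof of Cor. 2 / Milne 1972 Thm. 3,
`isIsogenous_quadraticTwist_cmFieldDiscr_holds`) — `W₁^{(d_K)}` are good at `p`, so
`f_p(W₁^{(d_K)}) = 0` (`conductorExponent_eq_zero_iff_holds`, Silverman *AT* IV.10.2(a)). But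
`p ∥ d_K` (`d_K = d₀e²`, `d₀` squarefree, `e ∣ 2`), so the twist of the `p`-GOOD curve `W₁` by
`d_K` has Kodaira type `I₀*` and `f_p = 2` — additive seat p4's
`conductorExponent_twist_of_semistable_eq_two` (Tate's algorithm, *AT* IV.9.4 Steps 6–7, IV.10.4).
Contradiction. Classically this is `|d_K| ∣ N_E` (Deuring; Gross, LNM 776; Serre–Tate), read here
off the twist isogeny instead of the Grössencharakter.

References: J. H. Silverman, *Advanced Topics* (1994) II Ex. 2.12(b), II.6.4, IV.9.4, IV.10.2,
IV.10.4, App. A §3 [SilvermanATAEC1994]; *AEC* (2009) VII.5.1, VII.7.2 [SilvermanAEC2009];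
A. Burungale, M. Flach, Camb. J. Math. 12 (2024), proof of Cor. 2 [BurungaleFlach2024];
J. E. Cremona, *Algorithms* (1997) §3.8 [Cremona1997]; harvest-1 RECLASSIFY.md §GEN-16.
-/

set_option autoImplicit false

noncomputable section

open scoped Classical

open IsDedekindDomain IsDedekindDomain.HeightOneSpectrum NumberField Rat.HeightOneSpectrum
  WeierstrassCurve Literature.NumberTheory.EllipticCurves
  Literature.NumberTheory.EllipticCurves.Rank1Residual Summit.BirchSwinnertonDyer.Rank1Residual.Additive

namespace Summit.BirchSwinnertonDyer.Rank1Residual.X12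

/-! ## §1 `p ∥ d_K` for an odd prime `p ∣ d_K` -/

/-- For `j ∈ maximalCMJInvariants` and an odd prime `p`: `p² ∤ d_K` (`d_K = d₀e²` with `d₀`
squarefree and `e ∣ 2`, gen 15 `exists_cmFieldDiscr_eq_mul_sq`). [cite: SilvermanATAEC1994, App. A §3 (first table)] -/
theorem not_sq_dvd_cmFieldDiscr {j : ℚ} (hj : j ∈ maximalCMJInvariants) {p : ℕ} (hp : p.Prime)
    (hp2 : p ≠ 2) : ¬ ((p : ℤ) ^ 2 ∣ cmFieldDiscr j) := by
  obtain ⟨d₀, e, hsf, he2, hde⟩ := exists_cmFieldDiscr_eq_mul_sq hj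
  intro h
  rw [hde, sq] at h
  have hpZ : Prime (p : ℤ) := Nat.prime_iff_prime_int.mp hp
  have hpe : ¬ (p : ℤ) ∣ (e : ℤ) := by
    intro hd
    have h2 : (p : ℤ) ∣ 2 := hd.trans (by exact_mod_cast he2)
    have : p ∣ 2 := by exact_mod_cast h2
    exact hp2 ((Nat.prime_dvd_prime_iff_eq hp Nat.prime_two).mp this)
  have hpe2 : ¬ (p : ℤ) ∣ (e : ℤ) ^ 2 := fun hd ↦ hpe (hpZ.dvd_of_dvd_pow hd)
  have hpd₀ : (p : ℤ) ∣ d₀ :=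
    (hpZ.dvd_or_dvd ((dvd_mul_right _ _).trans h)).resolve_right hpe2
  obtain ⟨m, hm⟩ := hpd₀
  have hpm : (p : ℤ) ∣ m := by
    rw [hm, mul_assoc] at h
    exact (hpZ.dvd_or_dvd ((mul_dvd_mul_iff_left hpZ.ne_zero).mp h)).resolve_right hpe2
  have hpp : (p : ℤ) * p ∣ d₀ := by rw [hm]; exact mul_dvd_mul_left _ hpm
  exact hpZ.not_unit (hsf _ hpp)

/-! ## §2 A CM curve is BAD at every odd prime ramified in its CM field -/

/-- **Maximal-order CM `j`, `p` odd, `p ∣ d_K` ⟹ bad reduction at `p`** (globally minimal model):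
otherwise the isogenous twist `W₁^{(d_K)}` (`isIsogenous_quadraticTwist_cmFieldDiscr_holds`) would
be good at `p` (*AEC* VII.7.2), whereas the twist of a `p`-good curve by `d_K`, `p ∥ d_K`, has
`f_p = 2` (`conductorExponent_twist_of_semistable_eq_two`, Tate's algorithm).
[cite: BurungaleFlach2024, proof of Cor. 2 (arXiv p. 4)] [cite: SilvermanAEC2009, Cor. VII.7.2]
[cite: SilvermanATAEC1994, IV.9.4 Steps 6–7 (PDF pp. 345–346)] -/
theorem not_good_of_mem_maximalCMJInvariants_of_dvd (W₁ : WeierstrassCurve ℚ) [W₁.IsElliptic]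
    [W₁.IsGloballyMinimal] (hj : W₁.j ∈ maximalCMJInvariants) (p : ℕ) [hp : Fact p.Prime]
    (hp2 : p ≠ 2) (hpd : (p : ℤ) ∣ cmFieldDiscr W₁.j) : ¬ W₁.HasGoodReductionAtPrime p := by
  intro hgood
  have hpp : p.Prime := hp.out
  have hsq := not_sq_dvd_cmFieldDiscr hj hpp hp2
  have hd0 : cmFieldDiscr W₁.j ≠ 0 := (cmFieldDiscr_neg hj).ne
  have hd0q : (cmFieldDiscr W₁.j : ℚ) ≠ 0 := by exact_mod_cast hd0
  -- the twist `W₁^{(d_K)}` is isogenous to `W₁`, hence good at `p`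
  have hiso : IsIsogenous W₁ (W₁.quadraticTwist (cmFieldDiscr W₁.j : ℚ)) :=
    isIsogenous_quadraticTwist_cmFieldDiscr_holds W₁ hj
  haveI := W₁.isElliptic_quadraticTwist hd0q
  have hgoodT : (W₁.quadraticTwist (cmFieldDiscr W₁.j : ℚ)).HasGoodReductionAtPrime p :=
    (hiso.hasGoodReductionAtPrime_iff p).mp hgood
  -- at the place `v` of `ℚ` over `p`
  obtain ⟨v, rfl⟩ : ∃ v : HeightOneSpectrum (𝓞 ℚ), (primesEquiv v : ℕ) = p :=
    ⟨primesEquiv.symm ⟨p, hpp⟩, by rw [Equiv.apply_symm_apply]⟩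
  have hgood₁v : W₁.HasGoodReductionAt v :=
    (hasGoodReductionAtPrime_iff_hasGoodReductionAt_ringOfIntegers v W₁).mp hgood
  have hgoodTv : (W₁.quadraticTwist (cmFieldDiscr W₁.j : ℚ)).HasGoodReductionAt v :=
    (hasGoodReductionAtPrime_iff_hasGoodReductionAt_ringOfIntegers v _).mp hgoodT
  haveI : Finite (IsLocalRing.ResidueField (v.adicCompletionIntegers ℚ)) :=
    HeightOneSpectrum.finite_residueField_adicCompletionIntegers ℚ v
  haveI : PerfectField (IsLocalRing.ResidueField (v.adicCompletionIntegers ℚ)) :=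
    PerfectField.ofFinite
  have hf0 : (W₁.quadraticTwist (cmFieldDiscr W₁.j : ℚ)).conductorExponent v = 0 :=
    (conductorExponent_eq_zero_iff_holds v (W₁.quadraticTwist (cmFieldDiscr W₁.j : ℚ))).mpr hgoodTv
  have hf2 : (W₁.quadraticTwist (cmFieldDiscr W₁.j : ℚ)).conductorExponent v = 2 :=
    conductorExponent_twist_of_semistable_eq_two v W₁ hp2 hd0 hpd hsq (Or.inl hgood₁v)
      (1 : VariableChange ℚ) (one_smul _ _)
  omega

/-- **CM curves over `ℚ` are BAD at every odd prime ramified in the CM field** — any model `W`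
with `cmFieldDiscrOfJ j(W) ≠ 0` (i.e. `j(W)` one of the thirteen CM `j`), `p` odd,
`p ∣ d_K = cmFieldDiscrOfJ j(W)`: `¬ good(p)`. Via the isogeny to the maximal order in the same
field (gen 15 `exists_isGloballyMinimal_isIsogenous_maximal_cmFieldDiscr_eq`) and isogeny
invariance of good reduction. Classically `|d_K| ∣ N_E`.
[cite: SilvermanAdvancedTopics1994, Exercise 2.12(b) and App. A §3 (p. 483)] [cite: SilvermanAEC2009, Cor. VII.7.2]
[cite: BurungaleFlach2024, proof of Cor. 2 (arXiv p. 4)] -/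
theorem not_good_of_dvd_cmFieldDiscrOfJ (W : WeierstrassCurve ℚ) [W.IsElliptic] (p : ℕ)
    [Fact p.Prime] (hp2 : p ≠ 2) (hd0 : cmFieldDiscrOfJ W.j ≠ 0)
    (hpd : (p : ℤ) ∣ cmFieldDiscrOfJ W.j) : ¬ W.HasGoodReductionAtPrime p := by
  have hj : W.j ∈ cmJInvariants := mem_cmJInvariants_of_cmFieldDiscrOfJ_ne_zero hd0
  obtain ⟨W₁, hE₁, hmin₁, hiso, hj₁, hd₁⟩ :=
    exists_isGloballyMinimal_isIsogenous_maximal_cmFieldDiscr_eq W hj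
  haveI := hE₁
  haveI := hmin₁
  intro hgood
  exact not_good_of_mem_maximalCMJInvariants_of_dvd W₁ hj₁ p hp2 (by rwa [hd₁])
    ((hiso.hasGoodReductionAtPrime_iff p).mp hgood)

/-- **`HasCM E`, `p` odd, `p ∣ d_K` ⟹ bad reduction at `p`** (`HasCM` form, through
`hasCM_iff_j_mem_holds`). [cite: SilvermanAEC2009, Cor. VII.7.2] [cite: BurungaleFlach2024, proof of Cor. 2 (arXiv p. 4)] -/
theorem not_good_of_hasCM_of_dvd_cmFieldDiscrOfJ (W : WeierstrassCurve ℚ) [W.IsElliptic]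
    (hCM : W.HasCM) (p : ℕ) [Fact p.Prime] (hp2 : p ≠ 2) (hpd : (p : ℤ) ∣ cmFieldDiscrOfJ W.j) :
    ¬ W.HasGoodReductionAtPrime p :=
  not_good_of_dvd_cmFieldDiscrOfJ W p hp2 (cmFieldDiscrOfJ_ne_zero_of_hasCM W hCM) hpd

/-! ## §3 Cell vocabulary -/

section Cell

variable (W : WeierstrassCurve ℚ) [W.IsElliptic] (p : ℕ) [hp : Fact p.Prime]

/-- **`cm ∧ p odd ∧ CMRamified ⟹ ¬ good(p)`**. [cite: SilvermanAEC2009, Cor. VII.7.2] [cite: BurungaleFlach2024, proof of Cor. 2 (arXiv p. 4)] -/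
theorem not_good_of_cmRamified (hCM : W.HasCM) (hp2 : p ≠ 2) (h : CMRamified W p) : ¬ Good W p :=
  not_good_of_hasCM_of_dvd_cmFieldDiscrOfJ W hCM p hp2 h

/-- **`cm ∧ p odd ∧ CMRamified ⟹ add(p)`** (bad by `not_good_of_cmRamified`, not multiplicative
by Silverman *AT* II.6.4, tree `not_mult_of_hasCM`).
[cite: SilvermanATAEC1994, Thm. II.6.4 (PDF p. 148) and proof of Thm. II.10.5 (PDF p. 172)] [cite: SilvermanAEC2009, Cor. VII.7.2] -/
theorem addv_of_hasCM_of_cmRamified (hCM : W.HasCM) (hp2 : p ≠ 2) (h : CMRamified W p) :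
    Addv W p :=
  ⟨not_good_of_cmRamified W p hCM hp2 h, not_mult_of_hasCM W hCM p⟩

/-- **At an odd ramified prime a CM pair is X3-shaped: `red(p) ∧ add(p)`** (gen 16
`red_of_cmRamified` + `addv_of_hasCM_of_cmRamified`). The PARTITION still files CM pairs under the
CM rows first; this records that the ramified X12 pairs lie in the Eisenstein-additive predicate.
[cite: Cremona1997, §3.8] [cite: SilvermanAEC2009, Cor. VII.7.2] -/
theorem classX3_of_hasCM_of_cmRamified (hCM : W.HasCM) (hp2 : p ≠ 2) (h : CMRamified W p) :
    ClassX3 W p :=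
  ⟨red_of_cmRamified W p hCM hp2 h, addv_of_hasCM_of_cmRamified W p hCM hp2 h⟩

/-- **A CM curve at an odd GOOD prime is unramified there: `good(p) ⟹ ¬ CMRamified`.**
[cite: SilvermanAEC2009, Cor. VII.7.2] [cite: BurungaleFlach2024, proof of Cor. 2 (arXiv p. 4)] -/
theorem not_cmRamified_of_hasCM_of_good (hCM : W.HasCM) (hp2 : p ≠ 2) (hgood : Good W p) :
    ¬ CMRamified W p :=
  fun h ↦ not_good_of_cmRamified W p hCM hp2 h hgood

/-- **A CM curve over `ℚ` has IRREDUCIBLE `E[p]` at every odd prime of good reduction** (`p = 3`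
included; gen 13's `irr_of_hasCM_of_good_of_five_le` needed `p ≥ 5`): good ⟹ unramified ⟹
irreducible (gen 15 `irr_of_not_cmRamified`). So the grid cells "cm ∧ good ∧ red, p odd" are EMPTY.
[cite: Mazur1978, §6 Prop. 6.3 (1) (p. 153)] [cite: SilvermanAEC2009, Cor. VII.7.2] -/
theorem irr_of_hasCM_of_good (hCM : W.HasCM) (hp2 : p ≠ 2) (hgood : Good W p) : Irr W p :=
  irr_of_not_cmRamified W p hp2 (not_cmRamified_of_hasCM_of_good W p hCM hp2 hgood)

/-- `cm ∧ good(p) ∧ p odd ⟹ ¬ red(p)`. [cite: Mazur1978, §6 Prop. 6.3 (1) (p. 153)] [cite: SilvermanAEC2009, Cor. VII.7.2] -/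
theorem not_red_of_hasCM_of_good (hCM : W.HasCM) (hp2 : p ≠ 2) (hgood : Good W p) : ¬ Red W p :=
  fun hred ↦ hred (irr_of_hasCM_of_good W p hCM hp2 hgood)

/-- **The odd-prime dichotomy for a CM curve over `ℚ`, with the reduction type:**
`(p ∤ d_K ∧ irr(p)) ∨ (p ∣ d_K ∧ red(p) ∧ add(p))`.
[cite: Mazur1978, Thm 1 (Introduction, pp. 129–130)] [cite: Cremona1997, §3.8] [cite: SilvermanAEC2009, Cor. VII.7.2] -/
theorem cm_odd_prime_dichotomy (hCM : W.HasCM) (hp2 : p ≠ 2) :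
    (¬ CMRamified W p ∧ Irr W p) ∨ (CMRamified W p ∧ Red W p ∧ Addv W p) := by
  by_cases h : CMRamified W p
  · exact Or.inr ⟨h, red_of_cmRamified W p hCM hp2 h, addv_of_hasCM_of_cmRamified W p hCM hp2 h⟩
  · exact Or.inl ⟨h, irr_of_not_cmRamified W p hp2 h⟩

/-- On class X12 at odd `p`: `CMRamified ⟹ ¬ good(p)`. [cite: SilvermanAEC2009, Cor. VII.7.2] -/
theorem not_good_of_classX12_of_cmRamified (hX : ClassX12 W p) (hp2 : p ≠ 2) (h : CMRamified W p) :
    ¬ Good W p :=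
  not_good_of_cmRamified W p hX.1 hp2 h

/-- **Every X12 pair at `p ≥ 5` is ADDITIVE at `p`** (ramified: this file; unramified: the class
predicate leaves only `¬ good`, gen 15 `not_good_of_classX12_of_not_cmRamified`; never
multiplicative: `not_mult_of_hasCM`). [cite: SilvermanATAEC1994, Thm. II.6.4 (PDF p. 148) and proof of Thm. II.10.5 (PDF p. 172)] [cite: SilvermanAEC2009, Cor. VII.7.2] -/
theorem addv_of_classX12_of_five_le (hX : ClassX12 W p) (hp5 : 5 ≤ p) : Addv W p := by
  by_cases h : CMRamified W p
  · exact addv_of_hasCM_of_cmRamified W p hX.1 (by omega) h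
  · exact ⟨not_good_of_classX12_of_not_cmRamified W p hX hp5 h, not_mult_of_hasCM W hX.1 p⟩

/-- `ClassX12 ∧ p ≥ 5 ⟹ ¬ good(p)`. [cite: SilvermanAEC2009, Cor. VII.7.2] -/
theorem not_good_of_classX12_of_five_le (hX : ClassX12 W p) (hp5 : 5 ≤ p) : ¬ Good W p :=
  (addv_of_classX12_of_five_le W p hX hp5).1

/-- **X12 at `p ≥ 5` lies inside the additive predicates: X3-shaped (`p ∣ d_K`: `red ∧ add`) or
X4-shaped (`p ∤ d_K`: `add ∧ irr`)** — by theorem, pair by pair decidable from `j`.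
[cite: Cremona1997, §3.8] [cite: Mazur1978, §6 Prop. 6.3 (1) (p. 153)] [cite: SilvermanAEC2009, Cor. VII.7.2] -/
theorem classX3_or_classX4_of_classX12_of_five_le (hX : ClassX12 W p) (hp5 : 5 ≤ p) :
    (CMRamified W p ∧ ClassX3 W p) ∨ (¬ CMRamified W p ∧ ClassX4 W p) := by
  by_cases h : CMRamified W p
  · exact Or.inl ⟨h, classX3_of_hasCM_of_cmRamified W p hX.1 (by omega) h⟩
  · exact Or.inr ⟨h, by omega, addv_of_classX12_of_five_le W p hX hp5,
      irr_of_not_cmRamified W p (by omega) h⟩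

end Cell

end Summit.BirchSwinnertonDyer.Rank1Residual.X12

end
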